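import Summits.HodgeConjecture.HodgeConjecture.Theorems.F0P3SpectralPacketHomogeneous   -- ★ (N) FILE 3w: `HomogPacketG`, `XiPacketsSignedHom`, `piXiHm` (+ ★ 3a `SpectralPacketG.n`; ★ 2 `GlobalPacket.hatCard`∕`nRecip`∕`IsImageOf`)
import Summits.HodgeConjecture.HodgeConjecture.Theorems.F0P3SpectralPacketH             -- ★ (N) FILE 3g: `SpectralPacketH`, `imageG`, `exists_discH_fin`
import HarnessLib

/-!
# The `n`-VALUES of the (N) tuple — `Card(Π̂)` and `n(Π) = Card(Π̂)⁻¹` READ BACK: `n = 1` (stable), `n = ½` (one discrete `H`-preimage, Thm. 13.3.7 for `Π(ξ)`) — kit-generic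

Cell `hodgecm-mathlib`, F0∕P3c line LH7 (closer stub `stub_PKtuple : PKtupleLetter`, `Cruxes/H413/Lines/F0_U3LettersRung1.lean` ED. 38 «PK-ε», row #181),
crux H413 = `stmt-HodgeConjecture-24833`; organ payer LH7-p03 (g0), DEFAULT organ «n-VALUE» (LH7 bus 02:2xZ; censuses `F0/P3c/LH7/LH7-p02/g0/CENSUS-PKtuple-inhouse.v1.md`
ec8ac256ebd4be69 §3 row (PK-A-G) «`n(Π(ξ)) = ½` … by construction ONCE `DiscH` marks exactly one `H`-preimage packet as discrete; ★ `tsum_germ_eq_half_mul_piXiHm` is the CONSUMER»,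
`F0/P3c/LH7/LH7-p01/g0/CENSUS-PKtuple-print.v1.1.md` f3ec0ab23d6c1399 row A-G).  `--supports stmt-HodgeConjecture-24833`; closes no stub.

THE MATHEMATICS [Rogawski1990 §13.3 p. 203; Thm. 13.3.7 pp. 202–203].  For a global packet `Π` of `G`, print sets `Π̂ := {ρ ∈ Π(H) : Π = Π(ρ)} ∪ {1}` and `n(Π) := Card(Π̂)⁻¹`;
★ (N) FILE 2 types this as `Π.hatCard DiscH := Nat.card {ρ // DiscH ρ ∧ Π.IsImageOf ρ} + 1` and `Π.nRecip DiscH := (hatCard)⁻¹ : ℚ`, RELATIVE TO the predicate `DiscH` singling out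
the discrete `H`-packets (the `H`-side automorphic measure is not typed), and ★ 3a sets `Q.n DiscH := ((Q.fin.nRecip DiscH : ℚ) : ℂ)` for a spectral packet `Q`.  Hence, by counting:
* `Card(Π̂) = 1`, `n(Π) = 1` iff NO discrete `H`-packet has image `Π` (print: `Π` stable) — or, by the `Nat.card` junk value, infinitely many do;
* `Card(Π̂) = 2`, `n(Π) = ½` iff EXACTLY ONE discrete `H`-packet has image `Π` — print's case `Π = Π(ξ)`, `Π̂(ξ) = {ξ, 1}` [Thm. 13.3.7: `n(Π(ξ)) = ½`], and the endoscopic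
  L-packets `Π(ρ)` with a unique preimage;
* in general `n(Π) = (k + 1)⁻¹` when the discrete preimages are `k` in number (print: `Card(Π̂) ∈ {1, 2, 4}`).
Since `Π.IsImageOf ρ` is PLACEWISE token equality `ξ_H(ρ_v) = Π_v` (★ FILE 2), uniqueness of the preimage follows from a placewise statement about the `ξ_H`-fibres of the
tokens `Π_v` (§2: `eq_of_forall_xiH_eq`), which is how a kit witness proves it (the `ξ_H`-fibre of the A-token `Π(ξ_v)` is the character packet `{ξ_v}`, Prop. 13.1.3 (d)).
In the letter `PKtupleLetter` (T-A :458) the predicate is `fun σ => ∃ P : 𝔞H.PktInfH, DiscH σ P` for the tuple's two-slot `DiscH`, and the conjunct reads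
`(piXiHm hXiS ξ).1.n (fun σ => ∃ P, DiscH σ P) = 1 / 2`; §4 states the reduction in exactly that shape: it HOLDS as soon as some spectral `H`-packet `ρ` (e.g. `rhoXiS hXiHS ξ`,
discrete by its field `isDiscrete`) has image `Π(ξ)_f` and every `DiscH`-discrete preimage of `Π(ξ)_f` is `ρ.fin`.

CONTENTS (namespaces of ★ FILE 2 `…F0P3GlobalPacket` and ★ 3a∕3g∕3w `…F0P3SpectralPacket`):
* §1 `GlobalPacketH.eq_of_loc_eq` (extensionality of the one-field structure); `GlobalPacket.IsImageOf.eq_of_forall_xiH_eq` (placewise fibre uniqueness ⇒ global uniqueness).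
* §2 `GlobalPacket`: `hatCard_eq`, `one_le_hatCard`, `hatCard_pos`, `nRecip_eq`, `nRecip_pos`, `nRecip_le_one`, `hatCard_eq_card_add_one` (finset of preimages),
  `hatCard_eq_one_of_forall_not` ∕ `nRecip_eq_one_of_forall_not` (stable), `hatCard_eq_two_iff` ∕ `nRecip_eq_half_iff` (`↔ ∃! ρ, DiscH ρ ∧ Π.IsImageOf ρ`),
  `hatCard_eq_two_of_existsUnique` ∕ `nRecip_eq_half_of_existsUnique`.
* §3 `SpectralPacketG`: `n_eq_inv_hatCard`, `n_ne_zero`, `n_eq_one_of_forall_not`, `n_eq_half_iff`, `n_eq_half_of_existsUnique`, `n_eq_half_of_unique` (witness + uniqueness),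
  `n_eq_half_of_forall_xiH_eq` (witness + placewise fibres).
* §4 the letter's shape: `SpectralPacketH.discH_fin` (`ρ.fin` is `(∃ P, DiscH · P)`-discrete), `SpectralPacketG.n_existsDisc_eq_half_of_unique`,
  `SpectralPacketG.piXiHm_n_eq_half_of_unique` ((PK-A-G)'s second conjunct, token for token, from «`ρ` has image `Π(ξ)_f` and is its only discrete preimage»),
  `SpectralPacketG.piXiHm_n_eq_half_of_forall_xiH_eq` (the same from the placewise fibre statement).
No instance, no notation, no named fact, no `sorry`.
HONEST LABEL: HC_CM is proved only modulo the 7 printed citations (2 remaining: hLiu418 = stmt-HodgeConjecture-24832, h413 = stmt-HodgeConjecture-24833) until rung 0 closes;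
this file proves no printed statement — it reduces the tuple's `n`-value conjuncts to preimage counts, kit-generically.

References: [Rogawski1990] §13.3 p. 203 (`Π̂`, `n(Π)`), Thm. 13.3.7 pp. 202–203, Thm. 13.3.4 p. 202, §13.1 p. 199, Prop. 13.1.3 (d) p. 199; §14.6 (14.6.1) p. 240.
-/

set_option autoImplicit false
-- the mandated namespace repeats `HodgeConjecture.HodgeConjecture`, as in every `Theorems/*.lean` of this sub-problem
set_option linter.dupNamespace false

noncomputable section

open NumberField IsDedekindDomain MeasureTheory
open Literature.NumberTheory Literature.NumberTheory.Automorphic Literature.NumberTheory.Automorphic.UnitaryGroup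
open Literature.NumberTheory.Rogawski1990 Literature.NumberTheory.GaloisRepresentations
open Literature.RepresentationTheory.BorelWallach2000 Literature.RepresentationTheory.KonnoKonno2007

/-! ## §1 Extensionality of `H`-packet families and placewise uniqueness of `ξ_H`-preimages [§13.1 p. 199; Thm. 13.3.4] -/

namespace Summit.HodgeConjecture.HodgeConjecture.Cruxes.H413.F0P3GlobalPacket

open Summit.HodgeConjecture.HodgeConjecture.Cruxes.H413.F0P3LocalPacketKit

variable {L : Type} [Field L] [NumberField L] [IsCMField L] {H' : Matrix (Fin 3) (Fin 3) L}
  {𝔩 : ∀ v : HeightOneSpectrum (𝓞 ↥(maximalRealSubfield L)), LocalPacketKit L H' v}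

/-- **Extensionality of `GlobalPacketH`**: an `H`-packet family is its placewise components `(ρ_v)_v` (the structure has the single field `loc`).
[cite: Rogawski1990, §13.3 p. 202] -/
theorem GlobalPacketH.eq_of_loc_eq {ρ ρ' : GlobalPacketH 𝔩} (h : ∀ v, ρ.loc v = ρ'.loc v) : ρ = ρ' := by
  cases ρ with
  | mk loc =>
    cases ρ' with
    | mk loc' =>
      have : loc = loc' := funext h
      subst this
      rfl

/-- `ρ = ρ′ ↔ ρ_v = ρ′_v` for all `v`. [cite: Rogawski1990, §13.3 p. 202] -/
theorem GlobalPacketH.eq_iff_forall_loc_eq (ρ ρ' : GlobalPacketH 𝔩) : ρ = ρ' ↔ ∀ v, ρ.loc v = ρ'.loc v :=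
  ⟨fun h _ => h ▸ rfl, GlobalPacketH.eq_of_loc_eq⟩

namespace GlobalPacket

/-- Unfolding of `IsImageOf`: `Π = Π(ρ)` is placewise token equality `ξ_H(ρ_v) = Π_v`. [cite: Rogawski1990, §13.1 p. 199; §13.3 Thm. 13.3.4 p. 202] -/
theorem isImageOf_iff (Pg : GlobalPacket 𝔩) (ρ : GlobalPacketH 𝔩) : Pg.IsImageOf ρ ↔ ∀ v, (𝔩 v).xiH (ρ.loc v) = Pg.loc v :=
  Iff.rfl

/-- **PLACEWISE FIBRE UNIQUENESS ⇒ GLOBAL UNIQUENESS OF THE PREIMAGE**: if at every place the only `H_v`-packet with `ξ_H`-image `Π_v` is `ρ₀_v`, then every `ρ` with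
`Π = Π(ρ)` is `ρ₀` (print for `Π = Π(ξ)`: the `ξ_H`-fibre of the A-packet `Π(ξ_v) = ξ_H(ξ_v)` is `{ξ_v}`, Prop. 13.1.3 (d)). [cite: Rogawski1990, §13.1 Prop. 13.1.3 (d) p. 199; §13.3 p. 203] -/
theorem IsImageOf.eq_of_forall_xiH_eq {Pg : GlobalPacket 𝔩} {ρ₀ ρ : GlobalPacketH 𝔩}
    (hfib : ∀ (v : HeightOneSpectrum (𝓞 ↥(maximalRealSubfield L))) (r : (𝔩 v).PktH), (𝔩 v).xiH r = Pg.loc v → r = ρ₀.loc v)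
    (hρ : Pg.IsImageOf ρ) : ρ = ρ₀ :=
  GlobalPacketH.eq_of_loc_eq fun v => hfib v (ρ.loc v) (hρ v)

/-! ## §2 `Card(Π̂)` and `n(Π) = Card(Π̂)⁻¹` counted [§13.3 p. 203; Thm. 13.3.7] -/

/-- Unfolding of `hatCard`: `Card(Π̂) = #{ρ discrete : Π = Π(ρ)} + 1`. [cite: Rogawski1990, §13.3 p. 203] -/
theorem hatCard_eq (Pg : GlobalPacket 𝔩) (DiscH : GlobalPacketH 𝔩 → Prop) :
    Pg.hatCard DiscH = Nat.card {ρ : GlobalPacketH 𝔩 // DiscH ρ ∧ Pg.IsImageOf ρ} + 1 :=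
  rfl

/-- `1 ≤ Card(Π̂)` (the element `1 ∈ Π̂`). [cite: Rogawski1990, §13.3 p. 203] -/
theorem one_le_hatCard (Pg : GlobalPacket 𝔩) (DiscH : GlobalPacketH 𝔩 → Prop) : 1 ≤ Pg.hatCard DiscH :=
  Nat.le_add_left 1 _

/-- `0 < Card(Π̂)`. [cite: Rogawski1990, §13.3 p. 203] -/
theorem hatCard_pos (Pg : GlobalPacket 𝔩) (DiscH : GlobalPacketH 𝔩 → Prop) : 0 < Pg.hatCard DiscH :=
  Pg.one_le_hatCard DiscH

/-- Unfolding of `nRecip`: `n(Π) = Card(Π̂)⁻¹`. [cite: Rogawski1990, §13.3 Thm. 13.3.7 pp. 202–203] -/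
theorem nRecip_eq (Pg : GlobalPacket 𝔩) (DiscH : GlobalPacketH 𝔩 → Prop) : Pg.nRecip DiscH = ((Pg.hatCard DiscH : ℕ) : ℚ)⁻¹ :=
  rfl

/-- `0 < n(Π)`. [cite: Rogawski1990, §13.3 Thm. 13.3.7 pp. 202–203] -/
theorem nRecip_pos (Pg : GlobalPacket 𝔩) (DiscH : GlobalPacketH 𝔩 → Prop) : 0 < Pg.nRecip DiscH := by
  rw [nRecip_eq]
  exact inv_pos.2 (by exact_mod_cast Pg.hatCard_pos DiscH)

/-- `n(Π) ≤ 1`. [cite: Rogawski1990, §13.3 Thm. 13.3.7 pp. 202–203] -/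
theorem nRecip_le_one (Pg : GlobalPacket 𝔩) (DiscH : GlobalPacketH 𝔩 → Prop) : Pg.nRecip DiscH ≤ 1 := by
  rw [nRecip_eq]
  exact inv_le_one_of_one_le₀ (by exact_mod_cast Pg.one_le_hatCard DiscH)

/-- `n(Π) ≠ 0`. [cite: Rogawski1990, §13.3 Thm. 13.3.7 pp. 202–203] -/
theorem nRecip_ne_zero (Pg : GlobalPacket 𝔩) (DiscH : GlobalPacketH 𝔩 → Prop) : Pg.nRecip DiscH ≠ 0 :=
  (Pg.nRecip_pos DiscH).ne'

/-- **`Card(Π̂) = #s + 1` when the discrete preimages of `Π` are exactly the finite set `s`** (print: `Card(Π̂) ∈ {1, 2, 4}`). [cite: Rogawski1990, §13.3 p. 203] -/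
theorem hatCard_eq_card_add_one (Pg : GlobalPacket 𝔩) (DiscH : GlobalPacketH 𝔩 → Prop) (s : Finset (GlobalPacketH 𝔩))
    (hs : ∀ ρ, ρ ∈ s ↔ DiscH ρ ∧ Pg.IsImageOf ρ) : Pg.hatCard DiscH = s.card + 1 := by
  rw [hatCard_eq]
  congr 1
  have e : {ρ : GlobalPacketH 𝔩 // DiscH ρ ∧ Pg.IsImageOf ρ} ≃ {ρ : GlobalPacketH 𝔩 // ρ ∈ s} :=
    Equiv.subtypeEquivRight fun ρ => (hs ρ).symm
  rw [Nat.card_congr e, Nat.card_eq_fintype_card, Fintype.card_coe]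

/-- `n(Π) = (#s + 1)⁻¹` when the discrete preimages of `Π` are exactly the finite set `s`. [cite: Rogawski1990, §13.3 Thm. 13.3.7 pp. 202–203] -/
theorem nRecip_eq_of_finset (Pg : GlobalPacket 𝔩) (DiscH : GlobalPacketH 𝔩 → Prop) (s : Finset (GlobalPacketH 𝔩))
    (hs : ∀ ρ, ρ ∈ s ↔ DiscH ρ ∧ Pg.IsImageOf ρ) : Pg.nRecip DiscH = ((s.card + 1 : ℕ) : ℚ)⁻¹ := by
  rw [nRecip_eq, Pg.hatCard_eq_card_add_one DiscH s hs]

/-- **STABLE CASE: `Card(Π̂) = 1` when no discrete `H`-packet has image `Π`.** [cite: Rogawski1990, §13.3 p. 203] -/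
theorem hatCard_eq_one_of_forall_not (Pg : GlobalPacket 𝔩) (DiscH : GlobalPacketH 𝔩 → Prop) (h : ∀ ρ, DiscH ρ → ¬ Pg.IsImageOf ρ) :
    Pg.hatCard DiscH = 1 := by
  haveI : IsEmpty {ρ : GlobalPacketH 𝔩 // DiscH ρ ∧ Pg.IsImageOf ρ} := ⟨fun ρ => h ρ.1 ρ.2.1 ρ.2.2⟩
  rw [hatCard_eq, Nat.card_of_isEmpty]

/-- **STABLE CASE: `n(Π) = 1` when no discrete `H`-packet has image `Π`.** [cite: Rogawski1990, §13.3 Thm. 13.3.7 pp. 202–203] -/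
theorem nRecip_eq_one_of_forall_not (Pg : GlobalPacket 𝔩) (DiscH : GlobalPacketH 𝔩 → Prop) (h : ∀ ρ, DiscH ρ → ¬ Pg.IsImageOf ρ) :
    Pg.nRecip DiscH = 1 := by
  rw [nRecip_eq, Pg.hatCard_eq_one_of_forall_not DiscH h]
  simp

/-- **`Card(Π̂) = 2 ↔` EXACTLY ONE discrete `H`-packet has image `Π`** (print's `Π̂(ξ) = {ξ, 1}`). [cite: Rogawski1990, §13.3 p. 203, Thm. 13.3.7 pp. 202–203] -/
theorem hatCard_eq_two_iff (Pg : GlobalPacket 𝔩) (DiscH : GlobalPacketH 𝔩 → Prop) :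
    Pg.hatCard DiscH = 2 ↔ ∃! ρ : GlobalPacketH 𝔩, DiscH ρ ∧ Pg.IsImageOf ρ := by
  rw [hatCard_eq, show (2 : ℕ) = 1 + 1 from rfl, Nat.add_right_cancel_iff, Nat.card_eq_one_iff_exists]
  constructor
  · rintro ⟨⟨ρ, hρ⟩, huniq⟩
    exact ⟨ρ, hρ, fun ρ' hρ' => congrArg Subtype.val (huniq ⟨ρ', hρ'⟩)⟩
  · rintro ⟨ρ, hρ, huniq⟩
    exact ⟨⟨ρ, hρ⟩, fun ρ' => Subtype.ext (huniq ρ'.1 ρ'.2)⟩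

/-- `Card(Π̂) = 2` from a unique discrete preimage. [cite: Rogawski1990, §13.3 p. 203] -/
theorem hatCard_eq_two_of_existsUnique (Pg : GlobalPacket 𝔩) (DiscH : GlobalPacketH 𝔩 → Prop) (h : ∃! ρ : GlobalPacketH 𝔩, DiscH ρ ∧ Pg.IsImageOf ρ) :
    Pg.hatCard DiscH = 2 :=
  (Pg.hatCard_eq_two_iff DiscH).2 h

/-- **`n(Π) = ½ ↔` EXACTLY ONE discrete `H`-packet has image `Π`** [Thm. 13.3.7: `n(Π(ξ)) = ½`]. [cite: Rogawski1990, §13.3 Thm. 13.3.7 pp. 202–203, p. 203] -/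
theorem nRecip_eq_half_iff (Pg : GlobalPacket 𝔩) (DiscH : GlobalPacketH 𝔩 → Prop) :
    Pg.nRecip DiscH = 1 / 2 ↔ ∃! ρ : GlobalPacketH 𝔩, DiscH ρ ∧ Pg.IsImageOf ρ := by
  rw [← hatCard_eq_two_iff, nRecip_eq, one_div, inv_inj, show (2 : ℚ) = ((2 : ℕ) : ℚ) from rfl, Nat.cast_inj]

/-- `n(Π) = ½` from a unique discrete preimage. [cite: Rogawski1990, §13.3 Thm. 13.3.7 pp. 202–203] -/
theorem nRecip_eq_half_of_existsUnique (Pg : GlobalPacket 𝔩) (DiscH : GlobalPacketH 𝔩 → Prop) (h : ∃! ρ : GlobalPacketH 𝔩, DiscH ρ ∧ Pg.IsImageOf ρ) :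
    Pg.nRecip DiscH = 1 / 2 :=
  (Pg.nRecip_eq_half_iff DiscH).2 h

/-- `n(Π) = ½` from a discrete preimage `ρ₀` and uniqueness among discrete preimages. [cite: Rogawski1990, §13.3 Thm. 13.3.7 pp. 202–203] -/
theorem nRecip_eq_half_of_unique (Pg : GlobalPacket 𝔩) (DiscH : GlobalPacketH 𝔩 → Prop) (ρ₀ : GlobalPacketH 𝔩) (h₀ : DiscH ρ₀) (himg : Pg.IsImageOf ρ₀)
    (huniq : ∀ ρ, DiscH ρ → Pg.IsImageOf ρ → ρ = ρ₀) : Pg.nRecip DiscH = 1 / 2 :=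
  Pg.nRecip_eq_half_of_existsUnique DiscH ⟨ρ₀, ⟨h₀, himg⟩, fun ρ hρ => huniq ρ hρ.1 hρ.2⟩

end GlobalPacket

end Summit.HodgeConjecture.HodgeConjecture.Cruxes.H413.F0P3GlobalPacket

/-! ## §3 The tuple coordinate `Q.n DiscH` of a spectral `G`-packet [Thm. 13.3.7; (14.6.1)] -/

namespace Summit.HodgeConjecture.HodgeConjecture.Cruxes.H413.F0P3SpectralPacket

open Summit.HodgeConjecture.HodgeConjecture.Cruxes.H413.F0P3LocalPacketKit
open Summit.HodgeConjecture.HodgeConjecture.Cruxes.H413.F0P3GlobalPacket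
open Summit.HodgeConjecture.HodgeConjecture.Cruxes.H413.F0P3ArchPacketKit

namespace SpectralPacketG

variable {L : Type} [Field L] [NumberField L] [IsCMField L] {H' : Matrix (Fin 3) (Fin 3) L}
  {𝔩 : ∀ v : HeightOneSpectrum (𝓞 ↥(maximalRealSubfield L)), LocalPacketKit L H' v} {𝔞 : ArchPacketKit}
  {μ : Measure (adelicGroupData (↥(maximalRealSubfield L)) L (IsCMField.complexConj L) 3 H').automorphicQuotient}
  [SMulInvariantMeasure (adelicGroupData (↥(maximalRealSubfield L)) L (IsCMField.complexConj L) 3 H').Adelic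
    (adelicGroupData (↥(maximalRealSubfield L)) L (IsCMField.complexConj L) 3 H').automorphicQuotient μ]

/-- `n(Q) = Card(Π̂)⁻¹` in `ℂ`. [cite: Rogawski1990, §13.3 Thm. 13.3.7 pp. 202–203] -/
theorem n_eq_inv_hatCard (Q : SpectralPacketG 𝔩 𝔞 μ) (DiscH : GlobalPacketH 𝔩 → Prop) :
    Q.n DiscH = ((Q.fin.hatCard DiscH : ℕ) : ℂ)⁻¹ := by
  rw [n_eq, GlobalPacket.nRecip_eq]
  push_cast
  rfl

/-- `n(Q) ≠ 0`. [cite: Rogawski1990, §13.3 Thm. 13.3.7 pp. 202–203] -/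
theorem n_ne_zero (Q : SpectralPacketG 𝔩 𝔞 μ) (DiscH : GlobalPacketH 𝔩 → Prop) : Q.n DiscH ≠ 0 := by
  rw [n_eq]
  exact_mod_cast Q.fin.nRecip_ne_zero DiscH

/-- **STABLE CASE: `n(Q) = 1`** when no discrete `H`-packet has image `Q_f`. [cite: Rogawski1990, §13.3 Thm. 13.3.7 pp. 202–203] -/
theorem n_eq_one_of_forall_not (Q : SpectralPacketG 𝔩 𝔞 μ) (DiscH : GlobalPacketH 𝔩 → Prop) (h : ∀ ρ, DiscH ρ → ¬ Q.fin.IsImageOf ρ) :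
    Q.n DiscH = 1 := by
  rw [n_eq, Q.fin.nRecip_eq_one_of_forall_not DiscH h]
  simp

/-- **`n(Q) = ½ ↔` exactly one discrete `H`-packet has image `Q_f`.** [cite: Rogawski1990, §13.3 Thm. 13.3.7 pp. 202–203, p. 203] -/
theorem n_eq_half_iff (Q : SpectralPacketG 𝔩 𝔞 μ) (DiscH : GlobalPacketH 𝔩 → Prop) :
    Q.n DiscH = 1 / 2 ↔ ∃! ρ : GlobalPacketH 𝔩, DiscH ρ ∧ Q.fin.IsImageOf ρ := by
  rw [← Q.fin.nRecip_eq_half_iff DiscH, n_eq]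
  constructor
  · intro h
    have h' : ((Q.fin.nRecip DiscH : ℚ) : ℂ) = ((1 / 2 : ℚ) : ℂ) := by rw [h]; push_cast; rfl
    exact_mod_cast h'
  · intro h
    rw [h]
    push_cast
    rfl

/-- `n(Q) = ½` from a unique discrete preimage. [cite: Rogawski1990, §13.3 Thm. 13.3.7 pp. 202–203] -/
theorem n_eq_half_of_existsUnique (Q : SpectralPacketG 𝔩 𝔞 μ) (DiscH : GlobalPacketH 𝔩 → Prop) (h : ∃! ρ : GlobalPacketH 𝔩, DiscH ρ ∧ Q.fin.IsImageOf ρ) :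
    Q.n DiscH = 1 / 2 :=
  (Q.n_eq_half_iff DiscH).2 h

/-- **`n(Q) = ½` FROM A DISCRETE PREIMAGE `ρ₀` AND UNIQUENESS among discrete preimages** (print for `Q = Π(ξ)`: `ρ₀ = ξ`, `Π̂(ξ) = {ξ, 1}`). [cite: Rogawski1990, §13.3 Thm. 13.3.7 pp. 202–203, p. 203] -/
theorem n_eq_half_of_unique (Q : SpectralPacketG 𝔩 𝔞 μ) (DiscH : GlobalPacketH 𝔩 → Prop) (ρ₀ : GlobalPacketH 𝔩) (h₀ : DiscH ρ₀) (himg : Q.fin.IsImageOf ρ₀)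
    (huniq : ∀ ρ, DiscH ρ → Q.fin.IsImageOf ρ → ρ = ρ₀) : Q.n DiscH = 1 / 2 :=
  Q.n_eq_half_of_existsUnique DiscH ⟨ρ₀, ⟨h₀, himg⟩, fun ρ hρ => huniq ρ hρ.1 hρ.2⟩

/-- **`n(Q) = ½` FROM A DISCRETE PREIMAGE `ρ₀` AND PLACEWISE `ξ_H`-FIBRES**: if `ρ₀` is discrete with `Q_f = Π(ρ₀)` and at every place the only `H_v`-packet with image `Q_v` is
`ρ₀_v`, then `n(Q) = ½` (no discreteness is needed for uniqueness). [cite: Rogawski1990, §13.3 Thm. 13.3.7 pp. 202–203; §13.1 Prop. 13.1.3 (d) p. 199] -/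
theorem n_eq_half_of_forall_xiH_eq (Q : SpectralPacketG 𝔩 𝔞 μ) (DiscH : GlobalPacketH 𝔩 → Prop) (ρ₀ : GlobalPacketH 𝔩) (h₀ : DiscH ρ₀) (himg : Q.fin.IsImageOf ρ₀)
    (hfib : ∀ (v : HeightOneSpectrum (𝓞 ↥(maximalRealSubfield L))) (r : (𝔩 v).PktH), (𝔩 v).xiH r = Q.fin.loc v → r = ρ₀.loc v) :
    Q.n DiscH = 1 / 2 :=
  Q.n_eq_half_of_unique DiscH ρ₀ h₀ himg fun _ _ hρ => hρ.eq_of_forall_xiH_eq hfib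

end SpectralPacketG

/-! ## §4 The letter's shape: the two-slot `DiscH σ P∞` read through `fun σ => ∃ P, DiscH σ P`, at `Π(ξ) = (piXiHm hXiS ξ).1` [T-A `PKtupleLetter` (PK-A-G); Thm. 13.3.7] -/

section LetterShape

variable {L : Type} [Field L] [NumberField L] [IsCMField L] {H' : Matrix (Fin 3) (Fin 3) L}
  {𝔩 : ∀ v : HeightOneSpectrum (𝓞 ↥(maximalRealSubfield L)), LocalPacketKit L H' v} {𝔞 : ArchPacketKit} {𝔞H : ArchPacketKitH 𝔞}
  {DiscH : GlobalPacketH 𝔩 → 𝔞H.PktInfH → Prop}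
  {μ : Measure (adelicGroupData (↥(maximalRealSubfield L)) L (IsCMField.complexConj L) 3 H').automorphicQuotient}
  [SMulInvariantMeasure (adelicGroupData (↥(maximalRealSubfield L)) L (IsCMField.complexConj L) 3 H').Adelic
    (adelicGroupData (↥(maximalRealSubfield L)) L (IsCMField.complexConj L) 3 H').automorphicQuotient μ]

/-- The finite part of a spectral `H`-packet is discrete for the one-slot predicate `fun σ => ∃ P∞, DiscH σ P∞` (★ 3g `exists_discH_fin`, restated in the letter's lambda shape).
[cite: Rogawski1990, §13.3 Thm. 13.3.7 pp. 202–203] -/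
theorem SpectralPacketH.discH_fin (ρ : SpectralPacketH 𝔩 𝔞 𝔞H DiscH) : (fun σ : GlobalPacketH 𝔩 => ∃ P : 𝔞H.PktInfH, DiscH σ P) ρ.fin :=
  ρ.exists_discH_fin

/-- **`n(Q) = ½` IN THE LETTER'S SHAPE** from a spectral `H`-packet `ρ` with `Q_f = Π(ρ)` that is the ONLY `DiscH`-discrete preimage of `Q_f`.
[cite: Rogawski1990, §13.3 Thm. 13.3.7 pp. 202–203, p. 203] -/
theorem SpectralPacketG.n_existsDisc_eq_half_of_unique (Q : SpectralPacketG 𝔩 𝔞 μ) (ρ : SpectralPacketH 𝔩 𝔞 𝔞H DiscH) (himg : Q.fin.IsImageOf ρ.fin)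
    (huniq : ∀ σ : GlobalPacketH 𝔩, (∃ P : 𝔞H.PktInfH, DiscH σ P) → Q.fin.IsImageOf σ → σ = ρ.fin) :
    Q.n (fun σ => ∃ P : 𝔞H.PktInfH, DiscH σ P) = 1 / 2 :=
  Q.n_eq_half_of_unique _ ρ.fin ρ.exists_discH_fin himg huniq

/-- **`n(Q) = ½` IN THE LETTER'S SHAPE from `Q_f = Π(ρ)` and placewise `ξ_H`-fibres.** [cite: Rogawski1990, §13.3 Thm. 13.3.7 pp. 202–203; §13.1 Prop. 13.1.3 (d) p. 199] -/
theorem SpectralPacketG.n_existsDisc_eq_half_of_forall_xiH_eq (Q : SpectralPacketG 𝔩 𝔞 μ) (ρ : SpectralPacketH 𝔩 𝔞 𝔞H DiscH) (himg : Q.fin.IsImageOf ρ.fin)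
    (hfib : ∀ (v : HeightOneSpectrum (𝓞 ↥(maximalRealSubfield L))) (r : (𝔩 v).PktH), (𝔩 v).xiH r = Q.fin.loc v → r = ρ.fin.loc v) :
    Q.n (fun σ => ∃ P : 𝔞H.PktInfH, DiscH σ P) = 1 / 2 :=
  Q.n_eq_half_of_forall_xiH_eq _ ρ.fin ρ.exists_discH_fin himg hfib

/-- `Π(ρ) = ρ.imageG` has `n = ½` as soon as `ρ.fin` is its only discrete preimage (the endoscopic∕A-packet value). [cite: Rogawski1990, §13.3 Thm. 13.3.7 pp. 202–203] -/
theorem SpectralPacketG.n_existsDisc_eq_half_of_fin_eq_imageG (Q : SpectralPacketG 𝔩 𝔞 μ) (ρ : SpectralPacketH 𝔩 𝔞 𝔞H DiscH) (hQ : Q.fin = ρ.imageG)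
    (huniq : ∀ σ : GlobalPacketH 𝔩, (∃ P : 𝔞H.PktInfH, DiscH σ P) → Q.fin.IsImageOf σ → σ = ρ.fin) :
    Q.n (fun σ => ∃ P : 𝔞H.PktInfH, DiscH σ P) = 1 / 2 :=
  Q.n_existsDisc_eq_half_of_unique ρ (hQ ▸ ρ.imageG_isImageOf) huniq

variable {infOf : GlobalPacket 𝔩 → 𝔞.PktInf} {aTok : ∀ v : HeightOneSpectrum (𝓞 ↥(maximalRealSubfield L)), Set (𝔩 v).Pkt}
  {PkX : OneDimAutRepH L → ∀ v : HeightOneSpectrum (𝓞 ↥(maximalRealSubfield L)), CMLocalAPacket L H' v}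
  {PkInfX : OneDimAutRepH L → LocalAPacket (GKIrrClass (uFormGroup (Fin 2) (Fin 1)))} {κX : OneDimAutRepH L → ℤ}

/-- **(PK-A-G), SECOND CONJUNCT, REDUCED — «`n(Π(ξ)) = ½`» [Thm. 13.3.7]** in the shape of T-A `PKtupleLetter` :458: for the tuple's `Π(ξ) := (piXiHm hXiS ξ).1` the value
`(piXiHm hXiS ξ).1.n (fun σ => ∃ P, DiscH σ P) = 1 / 2` HOLDS as soon as some spectral `H`-packet `ρ` (the tuple's `ρ(ξ) = rhoXiS hXiHS ξ`) has `Π(ξ)_f = Π(ρ)` and is the only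
`DiscH`-discrete preimage of `Π(ξ)_f` (print: `Π̂(ξ) = {ξ, 1}`, p. 203). [cite: Rogawski1990, §13.3 Thm. 13.3.7 pp. 202–203, p. 203; §14.6 (14.6.1) p. 240] -/
theorem SpectralPacketG.piXiHm_n_eq_half_of_unique (hXiS : SpectralPacketG.XiPacketsSignedHom 𝔩 𝔞 μ infOf aTok PkX PkInfX κX) (ξ : OneDimAutRepH L)
    (ρ : SpectralPacketH 𝔩 𝔞 𝔞H DiscH) (himg : (SpectralPacketG.piXiHm hXiS ξ).1.fin.IsImageOf ρ.fin)
    (huniq : ∀ σ : GlobalPacketH 𝔩, (∃ P : 𝔞H.PktInfH, DiscH σ P) → (SpectralPacketG.piXiHm hXiS ξ).1.fin.IsImageOf σ → σ = ρ.fin) :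
    (SpectralPacketG.piXiHm hXiS ξ).1.n (fun σ => ∃ P : 𝔞H.PktInfH, DiscH σ P) = 1 / 2 :=
  (SpectralPacketG.piXiHm hXiS ξ).1.n_existsDisc_eq_half_of_unique ρ himg huniq

/-- **(PK-A-G), SECOND CONJUNCT, REDUCED TO PLACEWISE FIBRES**: `n(Π(ξ)) = ½` from `Π(ξ)_f = Π(ρ)` and «at every `v` the only `H_v`-packet with `ξ_H`-image `Π(ξ)_v` is `ρ_v`»
(Prop. 13.1.3 (d): `Π(ξ_v) = ξ_H(ξ_v)` and the fibre is the character packet). [cite: Rogawski1990, §13.3 Thm. 13.3.7 pp. 202–203; §13.1 Prop. 13.1.3 (d) p. 199] -/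
theorem SpectralPacketG.piXiHm_n_eq_half_of_forall_xiH_eq (hXiS : SpectralPacketG.XiPacketsSignedHom 𝔩 𝔞 μ infOf aTok PkX PkInfX κX) (ξ : OneDimAutRepH L)
    (ρ : SpectralPacketH 𝔩 𝔞 𝔞H DiscH) (himg : (SpectralPacketG.piXiHm hXiS ξ).1.fin.IsImageOf ρ.fin)
    (hfib : ∀ (v : HeightOneSpectrum (𝓞 ↥(maximalRealSubfield L))) (r : (𝔩 v).PktH), (𝔩 v).xiH r = (SpectralPacketG.piXiHm hXiS ξ).1.fin.loc v → r = ρ.fin.loc v) :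
    (SpectralPacketG.piXiHm hXiS ξ).1.n (fun σ => ∃ P : 𝔞H.PktInfH, DiscH σ P) = 1 / 2 :=
  (SpectralPacketG.piXiHm hXiS ξ).1.n_existsDisc_eq_half_of_forall_xiH_eq ρ himg hfib

/-- **ALL ξ AT ONCE** — the conjunct `∀ ξ, (piXiHm hXiS ξ).1.n (fun σ => ∃ P, DiscH σ P) = 1 / 2` of (PK-A-G) from a family `ρ ξ` of spectral `H`-packets with images `Π(ξ)_f` and
placewise fibres. [cite: Rogawski1990, §13.3 Thm. 13.3.7 pp. 202–203; §13.1 Prop. 13.1.3 (d) p. 199] -/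
theorem SpectralPacketG.forall_piXiHm_n_eq_half_of_forall_xiH_eq (hXiS : SpectralPacketG.XiPacketsSignedHom 𝔩 𝔞 μ infOf aTok PkX PkInfX κX)
    (ρ : OneDimAutRepH L → SpectralPacketH 𝔩 𝔞 𝔞H DiscH) (himg : ∀ ξ, (SpectralPacketG.piXiHm hXiS ξ).1.fin.IsImageOf (ρ ξ).fin)
    (hfib : ∀ (ξ : OneDimAutRepH L) (v : HeightOneSpectrum (𝓞 ↥(maximalRealSubfield L))) (r : (𝔩 v).PktH),
      (𝔩 v).xiH r = (SpectralPacketG.piXiHm hXiS ξ).1.fin.loc v → r = (ρ ξ).fin.loc v) :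
    ∀ ξ : OneDimAutRepH L, (SpectralPacketG.piXiHm hXiS ξ).1.n (fun σ => ∃ P : 𝔞H.PktInfH, DiscH σ P) = 1 / 2 :=
  fun ξ => SpectralPacketG.piXiHm_n_eq_half_of_forall_xiH_eq hXiS ξ (ρ ξ) (himg ξ) (hfib ξ)

end LetterShape

end Summit.HodgeConjecture.HodgeConjecture.Cruxes.H413.F0P3SpectralPacket

end
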